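import Summits.NavierStokesRegularity.NavierStokesRegularity.Theorems.RellichScarSymmetricScarExistsIrrationalScarRotation

/-!
# Crux `SymmetricScarExists` (stmt-NavierStokesRegularity-11718), line `rdss-screw-split` —
# stub `stub_scarStabiliserClosed` (AUX-7): the scar stabiliser is closed in the screw group

Helper file of the line lead (`--supports stmt-NavierStokesRegularity-11718`; theorems only).
SCAR LEVEL.  Let `u` be an apex Type-I profile (suitable weak solution on the backward slab
`t < 0` with `𝐈 < ∞` and the apex bound `‖u‖ ≤ C/(‖x‖ + √−t)`, `C > 0`; no singularity is
assumed).  The screw group `ℝ₊ × SO(2)` acts on fields by `T_(c,θ) u := conjZ θ (nsRescale c u)`,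
`(T_(c,θ) u)(t,x) = R_θ c u(c²t, c R_{−θ} x)`.  We prove that the stabiliser of the SCAR of `u`,
`{(c, θ) | SameScar (T_(c,θ) u) u}`, is sequentially closed in `ℝ₊ × ℝ`: if `(c_j, θ_j) → (c₀, θ₀)`
with `c_j, c₀ > 0` and every `T_(c_j,θ_j)` fixes the scar, so does `T_(c₀,θ₀)`.

Proof (the screw-group version of the rotation-only `irrScarRot_isClosed_stabiliser_of_rate`).
Pass to the classical (mild) representative `V` of `u`
(`RellichScarScarRigidity.stub_apexMildRepresentative`; `SameScar` only sees the slab up to null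
sets, `sameScar_congr_ae`, and the screws preserve null sets of the slab, `nsRescale_ae_eq_slab`,
`conjZ_ae_eq_slab`) and to its scar `σ` with the cubic rate `‖V(t,x) − σ(x)‖ ≤ L(−t)/‖x‖³`, `σ`
locally Lipschitz off the origin (`stub_apexScarTrace`).  The screw transports the rate with the
same constant and the trace `x ↦ R_θ (c σ(c R_{−θ} x))` (`rate_nsRescale`, `rate_conjZ`), so the
defects `F_j := T_(c_j,θ_j) V − V` are continuous on the open slab with static traces
`τ_j(x) = R_{θ_j}(c_j σ(c_j R_{−θ_j} x)) − σ(x)` at rate `2L`, and `τ_j(x) → τ_∞(x)` for `x ≠ 0`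
because `σ` is continuous at `c₀ R_{−θ₀} x ≠ 0`.  Flatness of the defects
(`SameScar (T_(c_j,θ_j) V) V`) forces `τ_∞ = 0` off the origin (`static_limit_eq_zero_of_flat`:
esssup = sup on open boxes, `t ↑ 0`, `j → ∞`), whence `‖T_(c₀,θ₀) V − V‖ ≤ 2L(−t)/‖x‖³` and
`SameScar (T_(c₀,θ₀) V) V` (`tendsto_eLpNorm_top_of_rate`).

## References

* G. Koch, N. Nadirashvili, G. Seregin, V. Šverák, Acta Math. 203 (2009), §1 (1.6) and Prop. 4.1
  (scaling and rotation invariance, classical representatives). [folklore]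
* B. Pineau, V. Vicol, arXiv:2607.09619 (2026), §1.2 (the screw group `ℝ₊ × SO(2)` acting on
  profiles). [folklore]
-/

noncomputable section

open MeasureTheory Set Function Filter Topology TopologicalSpace Metric
open scoped NNReal ENNReal

namespace Summit.NavierStokesRegularity.NavierStokesRegularity.Theorems.SymmetricScarExists.RdssSplit.ScarLevel

set_option linter.dupNamespace false

open Literature.Analysis.FluidPDE
open Summit.NavierStokesRegularity.NavierStokesRegularity.Theses.RellichScar
open Summit.NavierStokesRegularity.NavierStokesRegularity.Theorems.SymmetricScarExists.Negative
open Summit.NavierStokesRegularity.NavierStokesRegularity.Theorems.SymmetricScarExists.ScarWindow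

/-! ## The screw images of the scar move continuously in the screw -/

/-- If `σ` is continuous off the origin, then along screws `(c_j, θ_j) → (c₀, θ₀)` with `c₀ ≠ 0`
the transported traces converge pointwise off the origin:
`R_{θ_j}(c_j σ(c_j R_{−θ_j} x)) → R_{θ₀}(c₀ σ(c₀ R_{−θ₀} x))` for `x ≠ 0` (`σ` is continuous at
`c₀ R_{−θ₀} x ≠ 0`, and `(θ, v) ↦ R_θ v` is continuous). [folklore] -/
theorem scarStab_tendsto_screw_trace {σ : EuclideanSpace ℝ (Fin 3) → EuclideanSpace ℝ (Fin 3)}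
    (hσ : ∀ x : EuclideanSpace ℝ (Fin 3), x ≠ 0 → ContinuousAt σ x)
    {c θ : ℕ → ℝ} {c₀ θ₀ : ℝ} (hc₀ : c₀ ≠ 0)
    (hc : Tendsto c atTop (𝓝 c₀)) (hθ : Tendsto θ atTop (𝓝 θ₀))
    {x : EuclideanSpace ℝ (Fin 3)} (hx : x ≠ 0) :
    Tendsto (fun j => rotZ (θ j) (c j • σ (c j • rotZ (-θ j) x))) atTop
      (𝓝 (rotZ θ₀ (c₀ • σ (c₀ • rotZ (-θ₀) x)))) := by
  have hcφ : Continuous fun φ : ℝ => rotZ (-φ) x :=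
    continuous_rotZ_uncurry.comp (f := fun φ : ℝ => (-φ, x))
      (continuous_neg.prodMk continuous_const)
  have hneg : Tendsto (fun j => rotZ (-θ j) x) atTop (𝓝 (rotZ (-θ₀) x)) :=
    (hcφ.tendsto θ₀).comp hθ
  have hsm : Tendsto (fun j => c j • rotZ (-θ j) x) atTop (𝓝 (c₀ • rotZ (-θ₀) x)) :=
    hc.smul hneg
  have hσx : Tendsto (fun j => σ (c j • rotZ (-θ j) x)) atTop (𝓝 (σ (c₀ • rotZ (-θ₀) x))) :=
    (hσ _ (smul_ne_zero hc₀ (rotZ_ne_zero (-θ₀) hx))).tendsto.comp hsm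
  have hsm2 : Tendsto (fun j => c j • σ (c j • rotZ (-θ j) x)) atTop
      (𝓝 (c₀ • σ (c₀ • rotZ (-θ₀) x))) :=
    hc.smul hσx
  exact (continuous_rotZ_uncurry.tendsto (θ₀, c₀ • σ (c₀ • rotZ (-θ₀) x))).comp
    (f := fun j => (θ j, c j • σ (c j • rotZ (-θ j) x))) (hθ.prodMk_nhds hsm2)

/-! ## The stabiliser of the scar in the screw group is sequentially closed -/

/-- **Closed screw stabiliser, classical form.**  Let `V` be continuous on the open slab `t < 0`
with a static trace `σ` at the cubic rate `‖V(t,x) − σ(x)‖ ≤ L(−t)/‖x‖³` (`L ≥ 0`), `σ`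
continuous off the origin.  If the screws `(c_j, θ_j) → (c₀, θ₀)` (`c_j, c₀ > 0`) satisfy
`SameScar (conjZ θ_j (nsRescale c_j V)) V` for every `j`, then
`SameScar (conjZ θ₀ (nsRescale c₀ V)) V`: the defects `conjZ θ_j (nsRescale c_j V) − V`
(continuous on the slab, traces `R_{θ_j}(c_j σ(c_j R_{−θ_j}·)) − σ` at rate `2L` by
`rate_nsRescale`/`rate_conjZ`, converging pointwise off the origin) are flat, so the limit trace
vanishes off the origin (`static_limit_eq_zero_of_flat`), and the cubic rate of
`conjZ θ₀ (nsRescale c₀ V) − V` gives the claim (`tendsto_eLpNorm_top_of_rate`). [folklore] -/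
theorem scarStab_isSeqClosed_of_rate
    {V : ℝ → EuclideanSpace ℝ (Fin 3) → EuclideanSpace ℝ (Fin 3)}
    {σ : EuclideanSpace ℝ (Fin 3) → EuclideanSpace ℝ (Fin 3)} {L : ℝ} (hL : 0 ≤ L)
    (hcont : ContinuousOn (uncurry V) (Iio (0 : ℝ) ×ˢ (univ : Set (EuclideanSpace ℝ (Fin 3)))))
    (hrate : ∀ t < (0 : ℝ), ∀ x : EuclideanSpace ℝ (Fin 3), x ≠ 0 →
      ‖V t x - σ x‖ ≤ L * (-t) / ‖x‖ ^ 3)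
    (hσ : ∀ x : EuclideanSpace ℝ (Fin 3), x ≠ 0 → ContinuousAt σ x)
    {c θ : ℕ → ℝ} {c₀ θ₀ : ℝ} (hcpos : ∀ j, 0 < c j) (hc₀ : 0 < c₀)
    (hc : Tendsto c atTop (𝓝 c₀)) (hθ : Tendsto θ atTop (𝓝 θ₀))
    (hS : ∀ j, SameScar (conjZ (θ j) (nsRescale (c j) V)) V) :
    SameScar (conjZ θ₀ (nsRescale c₀ V)) V := by
  -- Step 1: the limit static defect vanishes off the origin
  have hfix : ∀ x : EuclideanSpace ℝ (Fin 3), x ≠ 0 →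
      rotZ θ₀ (c₀ • σ (c₀ • rotZ (-θ₀) x)) - σ x = 0 := by
    intro x hx
    refine static_limit_eq_zero_of_flat
      (F := fun j => uncurry (conjZ (θ j) (nsRescale (c j) V)) - uncurry V)
      (τ := fun j y => rotZ (θ j) (c j • σ (c j • rotZ (-θ j) y)) - σ y)
      (τl := fun y => rotZ θ₀ (c₀ • σ (c₀ • rotZ (-θ₀) y)) - σ y) (M := L + L)
      (fun j => (continuousOn_uncurry_conjZ (θ j)
        (continuousOn_uncurry_nsRescale (hcpos j) hcont)).sub hcont) ?_ ?_ ?_ hx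
    · intro j t ht y hy
      have h1 := rate_conjZ (σ := fun z => c j • σ (c j • z)) (θ j)
        (rate_nsRescale (hcpos j) hrate) t ht y hy
      have h2 := hrate t ht y hy
      calc ‖(uncurry (conjZ (θ j) (nsRescale (c j) V)) - uncurry V) (t, y)
              - (rotZ (θ j) (c j • σ (c j • rotZ (-θ j) y)) - σ y)‖
          = ‖(conjZ (θ j) (nsRescale (c j) V) t y - rotZ (θ j) (c j • σ (c j • rotZ (-θ j) y)))
              - (V t y - σ y)‖ := by
            congr 1
            show (conjZ (θ j) (nsRescale (c j) V) t y - V t y) - _ = _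
            abel
        _ ≤ ‖conjZ (θ j) (nsRescale (c j) V) t y - rotZ (θ j) (c j • σ (c j • rotZ (-θ j) y))‖
              + ‖V t y - σ y‖ := norm_sub_le _ _
        _ ≤ L * (-t) / ‖y‖ ^ 3 + L * (-t) / ‖y‖ ^ 3 := add_le_add h1 h2
        _ = (L + L) * (-t) / ‖y‖ ^ 3 := by ring
    · -- the static defects converge pointwise off the origin (`σ` is continuous there)
      intro y hy
      exact (scarStab_tendsto_screw_trace hσ hc₀.ne' hc hθ hy).sub tendsto_const_nhds
    · -- the defects are flat: `SameScar (conjZ (θ j) (nsRescale (c j) V)) V` for every `j`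
      intro K hK h0 ε hε
      refine Eventually.of_forall fun j => ?_
      exact (ENNReal.tendsto_nhds_zero.1 (hS j K hK h0)) (ENNReal.ofReal ε) (ENNReal.ofReal_pos.2 hε)
  -- Step 2: the defect of the limit screw has the cubic rate, hence a zero scar functional
  intro K hK h0
  refine tendsto_eLpNorm_top_of_rate (D := uncurry (conjZ θ₀ (nsRescale c₀ V)) - uncurry V)
    (M := L + L) (by positivity) ?_ hK h0
  intro t ht x hx
  have h1 := rate_conjZ (σ := fun z => c₀ • σ (c₀ • z)) θ₀ (rate_nsRescale hc₀ hrate) t ht x hx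
  have h2 := hrate t ht x hx
  have h3 : rotZ θ₀ (c₀ • σ (c₀ • rotZ (-θ₀) x)) = σ x := sub_eq_zero.1 (hfix x hx)
  calc ‖(uncurry (conjZ θ₀ (nsRescale c₀ V)) - uncurry V) (t, x)‖
      = ‖(conjZ θ₀ (nsRescale c₀ V) t x - rotZ θ₀ (c₀ • σ (c₀ • rotZ (-θ₀) x)))
          - (V t x - σ x)‖ := by
        congr 1
        show conjZ θ₀ (nsRescale c₀ V) t x - V t x = _
        rw [h3]
        abel
    _ ≤ ‖conjZ θ₀ (nsRescale c₀ V) t x - rotZ θ₀ (c₀ • σ (c₀ • rotZ (-θ₀) x))‖ + ‖V t x - σ x‖ :=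
        norm_sub_le _ _
    _ ≤ L * (-t) / ‖x‖ ^ 3 + L * (-t) / ‖x‖ ^ 3 := add_le_add h1 h2
    _ = (L + L) * (-t) / ‖x‖ ^ 3 := by ring

/-- **Closed screw stabiliser, apex form.**  For an apex Type-I profile `u` (suitable weak
solution on the backward slab, `𝐈 < ∞`, apex bound of constant `C > 0`), if the screws
`(c_j, θ_j) → (c₀, θ₀)` (`c_j, c₀ > 0`) satisfy `SameScar (conjZ θ_j (nsRescale c_j u)) u`, then
`SameScar (conjZ θ₀ (nsRescale c₀ u)) u`: replace `u` by its classical representative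
(`stub_apexMildRepresentative`; `sameScar_congr_ae`, `nsRescale_ae_eq_slab`, `conjZ_ae_eq_slab`),
which has a scar with the cubic rate and local Lipschitz bound (`stub_apexScarTrace`,
`irrScarRot_continuousAt_scar`), and apply `scarStab_isSeqClosed_of_rate`. [folklore] -/
theorem scarStab_isSeqClosed_apex
    (u : ℝ → EuclideanSpace ℝ (Fin 3) → EuclideanSpace ℝ (Fin 3))
    (p : ℝ → EuclideanSpace ℝ (Fin 3) → ℝ)
    (G : ℝ → EuclideanSpace ℝ (Fin 3) → EuclideanSpace ℝ (Fin 3) →L[ℝ] EuclideanSpace ℝ (Fin 3))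
    {C : ℝ} (hC : 0 < C)
    (hsw : IsSuitableWeakSolutionOn (slab (EuclideanSpace ℝ (Fin 3)) (Iio (0 : ℝ)) isOpen_Iio) 1 0 u p)
    (hwg : HasWeakSpatialGradientOn (slab (EuclideanSpace ℝ (Fin 3)) (Iio (0 : ℝ)) isOpen_Iio) u G)
    (hI : typeIBound (Iio (0 : ℝ) ×ˢ univ) u p G < ⊤) (hdec : HasTypeIDecay C u)
    {c θ : ℕ → ℝ} {c₀ θ₀ : ℝ} (hcpos : ∀ j, 0 < c j) (hc₀ : 0 < c₀)
    (hc : Tendsto c atTop (𝓝 c₀)) (hθ : Tendsto θ atTop (𝓝 θ₀))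
    (hS : ∀ j, SameScar (conjZ (θ j) (nsRescale (c j) u)) u) :
    SameScar (conjZ θ₀ (nsRescale c₀ u)) u := by
  obtain ⟨V, hae, hmild, hdecV⟩ :=
    RellichScarScarRigidity.stub_apexMildRepresentative u p G C hC hsw hwg hI hdec
  obtain ⟨L, hL, hB1⟩ := stub_apexScarTrace C hC
  obtain ⟨σ, hrate, -, hlip⟩ := hB1 V hmild hdecV
  have hSV : ∀ j, SameScar (conjZ (θ j) (nsRescale (c j) V)) V := fun j =>
    (sameScar_congr_ae (conjZ_ae_eq_slab (θ j) (nsRescale_ae_eq_slab (hcpos j) hae)) hae).2 (hS j)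
  exact (sameScar_congr_ae (conjZ_ae_eq_slab θ₀ (nsRescale_ae_eq_slab hc₀ hae)) hae).1
    (scarStab_isSeqClosed_of_rate hL hmild.continuousOn_uncurry hrate
      (fun x hx => irrScarRot_continuousAt_scar hlip hx) hcpos hc₀ hc hθ hSV)

/-! ## The registered stub -/

/-- **AUX-7 `stub_scarStabiliserClosed`** (line `rdss-screw-split` of crux
stmt-NavierStokesRegularity-11718), SCAR LEVEL: the scar stabiliser of an apex Type-I profile `u`
is closed in the screw group `ℝ₊ × SO(2)` — if the screws `(c_j, θ_j) → (c₀, θ₀)` (`c_j, c₀ > 0`)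
all fix the scar of `u` (`SameScar (conjZ θ_j (nsRescale c_j u)) u`, unfolded), so does
`(c₀, θ₀)`.  Mild representative (`stub_apexMildRepresentative`), scar with the cubic rate
(`stub_apexScarTrace`), `static_limit_eq_zero_of_flat` along the sequence,
`tendsto_eLpNorm_top_of_rate` (`scarStab_isSeqClosed_apex`); the rotation-only case is
`irrScarRot_isClosed_stabiliser_apex`. [folklore] -/
theorem stub_scarStabiliserClosed : ∀ (u : ℝ → EuclideanSpace ℝ (Fin 3) → EuclideanSpace ℝ (Fin 3)) (p : ℝ → EuclideanSpace ℝ (Fin 3) → ℝ) (G : ℝ → EuclideanSpace ℝ (Fin 3) → EuclideanSpace ℝ (Fin 3) →L[ℝ] EuclideanSpace ℝ (Fin 3)) (C : ℝ), 0 < C → Literature.Analysis.FluidPDE.IsSuitableWeakSolutionOn (Literature.Analysis.FluidPDE.slab (EuclideanSpace ℝ (Fin 3)) (Set.Iio 0) isOpen_Iio) 1 0 u p → Literature.Analysis.FluidPDE.HasWeakSpatialGradientOn (Literature.Analysis.FluidPDE.slab (EuclideanSpace ℝ (Fin 3)) (Set.Iio 0) isOpen_Iio) u G → Literature.Analysis.FluidPDE.typeIBound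 (Set.Iio (0 : ℝ) ×ˢ Set.univ) u p G < ⊤ → Literature.Analysis.FluidPDE.HasTypeIDecay C u → ∀ (c θ : ℕ → ℝ) (c₀ θ₀ : ℝ), (∀ j : ℕ, 0 < c j) → 0 < c₀ → Filter.Tendsto c Filter.atTop (nhds c₀) → Filter.Tendsto θ Filter.atTop (nhds θ₀) → (∀ j : ℕ, ∀ K : Set (EuclideanSpace ℝ (Fin 3)), IsCompact K → (0 : EuclideanSpace ℝ (Fin 3)) ∉ K → Filter.Tendsto (fun δ : ℝ => MeasureTheory.eLpNorm (Function.uncurry (fun t x => Literature.Analysis.FluidPDE.rotZ (θ j) (Literature.Analysis.FluidPDE.nsRescale (c j) u t (Literature.Analysis.FluidPDE.rotZ (-(θ j)) x))) - Function.uncurry u) ⊤ (MeasureTheory.volume.restrict (Set.Ioo (-δ) 0 ×ˢ K))) (nhdsWithin 0 (Set.Ioi 0)) (nhds 0)) → ∀ K : Set (EuclideanSpace ℝ (Fin 3)), IsCompact K → (0 : EuclideanSpace ℝ (Fin 3)) ∉ K → Filter.Tendsto (fun δ : ℝ => MeasureTheory.eLpNorm (Function.uncurry (fun t x => Literature.Analysis.FluidPDE.rotZ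 θ₀ (Literature.Analysis.FluidPDE.nsRescale c₀ u t (Literature.Analysis.FluidPDE.rotZ (-θ₀) x))) - Function.uncurry u) ⊤ (MeasureTheory.volume.restrict (Set.Ioo (-δ) 0 ×ˢ K))) (nhdsWithin 0 (Set.Ioi 0)) (nhds 0) := by
  intro u p G C hC hsw hwg hI hdec c θ c₀ θ₀ hcpos hc₀ hc hθ hS
  change ∀ j : ℕ, SameScar (conjZ (θ j) (nsRescale (c j) u)) u at hS
  show SameScar (conjZ θ₀ (nsRescale c₀ u)) u
  exact scarStab_isSeqClosed_apex u p G hC hsw hwg hI hdec hcpos hc₀ hc hθ hS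

end Summit.NavierStokesRegularity.NavierStokesRegularity.Theorems.SymmetricScarExists.RdssSplit.ScarLevel

end
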